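import Mathlib
import Summits.NavierStokesRegularity.NavierStokesRegularity.Theorems.LerayQuarterDissipationFiniteDissipationLiouvilleLambProductRigidity
import Summits.NavierStokesRegularity.NavierStokesRegularity.Theorems.LerayQuarterDissipationFiniteDissipationLiouvilleEndpointSchemeSlack
import HarnessLib

/-!
# Crux `FiniteDissipationLiouville` (stmt-NavierStokesRegularity-22144): THE PRODUCT THRESHOLD ONE
# IS NOT ATTAINED — every enveloped Type-I ancient mild field with
# `√(−t)⟪u, ω × curl ω⟫ ≤ ‖ω‖‖curl ω‖` everywhere vanishes (law-free; `θ ≤ 1` instead of `θ < 1`)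

Theorems file of route `LerayQuarterDissipation` (lead prover g18; `--supports` the crux; sequel of
`…LambProductRigidity`, `…EndpointScheme(Slack)`). Navier–Stokes regularity is NOT proved by
anything here; no summit is.

The tree's PRODUCT row T49′ (pub-ns-dss `…SimilarityEnstrophy.typeI_ancient_eq_zero_of_lambProduct_lt_one_sim`):
an enveloped KNSS-gauge Type-I field with `⟪U, Ω × curl Ω⟫ ≤ θ‖Ω‖‖curl Ω‖` on its Leray orbit,
`θ < 1`, vanishes. It contains the Λ-directional row T49, the cross-flow row and the time-constant
row. This file settles the ENDPOINT `θ = 1` of the whole product row through the antitone-enstrophy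
endpoint scheme (`…EndpointSchemeSlack.eq_zero_of_slack_scheme`), with the analytic rigidity of
`…LambProductRigidity`:

* `lambProduct_nsRescale`, `lambProduct_sim_of_phys` — the physical hypothesis
  `√(−t)⟪V, ω × curl ω⟫ ≤ ‖ω‖‖curl ω‖` (`ω = curl V(t)`) is scale invariant; its similarity form;
* `lambProduct_closed` — it is CLOSED under the KNSS convergence of `…Compactness.seqLimit`
  (second vorticity derivatives converge at every `t < 0`, `…EndpointScheme.tendsto_curl_curl_of_unif`);
* **`eq_zero_of_lambProduct_le_one`** — **every KNSS-gauge Type-I ancient mild field `V`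
  (`IsTypeIAncientMild C V`) with a Type-I envelope `HasTypeIDecay C V` and
  `√(−t)⟪V(t,x), ω × curl ω⟫ ≤ ‖ω‖‖curl ω‖` at every `t < 0`, `x` VANISHES IDENTICALLY**;
* corollaries at the endpoint `θ = 1` of the three sub-rows: `eq_zero_of_lambDirection_le_one`
  (Λ-directional: `√(−t)⟪V, Λ⟫ ≤ ‖Λ‖`, `Λ = ω × curl ω`), the cross-flow endpoint of lead g17
  re-derived (an `example`), and **`eq_zero_of_typeI_le_one_of_hasTypeIDecay`: an enveloped
  KNSS-gauge Type-I field with Type-I constant `C ≤ 1` vanishes** (law-free THRESHOLD ONE on the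
  enveloped class; the tree's T31⁗ has `C < 1` without envelope, lead g14's `…ThresholdOne` has
  `C ≤ 1` on the finite-dissipation stratum);
* `not_singular_of_lambProduct_le_one`, **`lambProduct_exceeds_of_singular`** — PORTRAIT: a singular
  enveloped member has a point where `‖ω‖‖curl ω‖ < √(−t)⟪V, ω × curl ω⟫`: the velocity component
  along the vortex-Lamb vector `ω × curl ω`, weighted by `sin∠(ω, curl ω)`, STRICTLY EXCEEDS the
  self-similar speed somewhere;
* `eq_zero_of_typeI_dss_of_lambProduct_le_one` — Bradshaw–Tsai OP 5.1 holds, every factor, on the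
  Type-I DSS fields with the product bound (an instance of the law-free theorem).

HONEST FRAMING. An endpoint improvement (`θ < 1` ⇒ `θ ≤ 1`) of a law-free threshold row about a
HYPOTHETICAL object, unifying three endpoint statements; ineffective beyond the endpoint (the collar
is in the sequel, by compactness). Nothing is removed from the catalogued DSS wall beyond this
sub-class; verdict of the line unchanged (FRONTIER). Nothing here bears on Navier–Stokes regularity.

References: Koch–Nadirashvili–Seregin–Šverák, Acta Math. 203 (2009) §4; Bradshaw–Tsai, Comm. PDE
42 (2017) §5 (OP 5.1); Chae–Wolf, arXiv:1610.09464 §4; Lemarié-Rieusset (2016) Thm 9.12.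
-/

noncomputable section

set_option linter.dupNamespace false

namespace Summit.NavierStokesRegularity.NavierStokesRegularity.Theorems.FiniteDissipationLiouville.LambProduct

open MeasureTheory Set Filter Topology Metric InnerProductSpace Function Real
open scoped RealInnerProductSpace ContDiff
open Literature.Analysis Literature.Analysis.FluidPDE
open Summit.NavierStokesRegularity.NavierStokesRegularity.Theorems
open Summit.NavierStokesRegularity.NavierStokesRegularity.Theorems.GaussianGap
open Summit.NavierStokesRegularity.NavierStokesRegularity.Theorems.SimilarityEnstrophy
open Summit.NavierStokesRegularity.NavierStokesRegularity.Theorems.RecurrentReductionD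
open Summit.NavierStokesRegularity.NavierStokesRegularity.Theorems.FiniteDissipationLiouville
open Summit.NavierStokesRegularity.NavierStokesRegularity.Theorems.FiniteDissipationLiouville.CrossFlow
open Summit.NavierStokesRegularity.NavierStokesRegularity.Theorems.FiniteDissipationLiouville.EndpointScheme

variable {C : ℝ} {V : ℝ → EuclideanSpace ℝ (Fin 3) → EuclideanSpace ℝ (Fin 3)}

/-! ### Scaling bookkeeping -/

section Scaling

/-- **The product hypothesis is scale invariant.** [folklore] -/
theorem lambProduct_nsRescale {c : ℝ} (hc : 0 < c)
    (hP : ∀ t < 0, ∀ x, Real.sqrt (-t) * ⟪V t x, cross (curl (V t) x) (curl (curl (V t)) x)⟫ ≤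
      ‖curl (V t) x‖ * ‖curl (curl (V t)) x‖) :
    ∀ t < 0, ∀ x, Real.sqrt (-t) *
        ⟪nsRescale c V t x, cross (curl (nsRescale c V t) x) (curl (curl (nsRescale c V t)) x)⟫ ≤
      ‖curl (nsRescale c V t) x‖ * ‖curl (curl (nsRescale c V t)) x‖ := by
  intro t ht x
  have hct : c ^ 2 * t < 0 := mul_neg_of_pos_of_neg (by positivity) ht
  have key := hP (c ^ 2 * t) hct (c • x)
  have hsq : Real.sqrt (-(c ^ 2 * t)) = c * Real.sqrt (-t) := by
    rw [show -(c ^ 2 * t) = c ^ 2 * -t by ring, Real.sqrt_mul (sq_nonneg c), Real.sqrt_sq hc.le]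
  rw [hsq] at key
  have hcurl : curl (nsRescale c V t) x = (c * c) • curl (V (c ^ 2 * t)) (c • x) := by
    rw [curl_eq_curlCLM, fderiv_nsRescale, map_smul, ← curl_eq_curlCLM]
  rw [hcurl, curl_curl_nsRescale, nsRescale_apply, cross_smul_left, cross_smul_right,
    real_inner_smul_left, real_inner_smul_right, real_inner_smul_right, norm_smul, norm_smul,
    Real.norm_of_nonneg (by positivity : (0:ℝ) ≤ c * c),
    Real.norm_of_nonneg (by positivity : (0:ℝ) ≤ c * c * c)]
  have hw : 0 ≤ c * c * (c * c * c) := by positivity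
  calc Real.sqrt (-t) * (c * (c * c * (c * c * c *
        ⟪V (c ^ 2 * t) (c • x), cross (curl (V (c ^ 2 * t)) (c • x)) (curl (curl (V (c ^ 2 * t))) (c • x))⟫)))
      = c * c * (c * c * c) * (c * Real.sqrt (-t) *
        ⟪V (c ^ 2 * t) (c • x), cross (curl (V (c ^ 2 * t)) (c • x)) (curl (curl (V (c ^ 2 * t))) (c • x))⟫) := by
        ring
    _ ≤ c * c * (c * c * c) * (‖curl (V (c ^ 2 * t)) (c • x)‖ * ‖curl (curl (V (c ^ 2 * t))) (c • x)‖) :=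
        mul_le_mul_of_nonneg_left key hw
    _ = c * c * ‖curl (V (c ^ 2 * t)) (c • x)‖ * (c * c * c * ‖curl (curl (V (c ^ 2 * t))) (c • x)‖) := by
        ring

/-- **The product hypothesis in similarity variables**: `√(−t)⟪V, ω × curl ω⟫ ≤ ‖ω‖‖curl ω‖` for all
`t < 0`, `x` gives `⟪U, Ω × curl Ω⟫ ≤ ‖Ω‖‖curl Ω‖` on the Leray orbit (both sides scale by
`(−t)^{5/2}·√(−t)` resp. `(−t)^{5/2}`). [folklore] -/
theorem lambProduct_sim_of_phys
    (hP : ∀ t < 0, ∀ x, Real.sqrt (-t) * ⟪V t x, cross (curl (V t) x) (curl (curl (V t)) x)⟫ ≤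
      ‖curl (V t) x‖ * ‖curl (curl (V t)) x‖)
    (s : ℝ) (y : EuclideanSpace ℝ (Fin 3)) :
    ⟪lerayOrbit V s y, cross (lerayVorticity V s y) (curl (lerayVorticity V s) y)⟫ ≤
      ‖lerayVorticity V s y‖ * ‖curl (lerayVorticity V s) y‖ := by
  have hl0 : 0 < Real.exp (-s / 2) := Real.exp_pos _
  have hk0 : 0 < Real.exp (-s) := Real.exp_pos _
  have ht0 : -Real.exp (-s) < 0 := neg_neg_of_pos hk0
  have hU : lerayOrbit V s y = Real.exp (-s / 2) • V (-Real.exp (-s)) (Real.exp (-s / 2) • y) := by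
    rw [lerayOrbit_apply]
  have hΩ : lerayVorticity V s y =
      Real.exp (-s) • curl (V (-Real.exp (-s))) (Real.exp (-s / 2) • y) := by
    rw [lerayVorticity_apply, curl_lerayOrbit]
  have hC := curl_lerayVorticity_apply V s y
  have h := hP _ ht0 (Real.exp (-s / 2) • y)
  rw [neg_neg, sqrt_exp_neg] at h
  set P : ℝ := ⟪V (-Real.exp (-s)) (Real.exp (-s / 2) • y),
      cross (curl (V (-Real.exp (-s))) (Real.exp (-s / 2) • y))
        (curl (curl (V (-Real.exp (-s)))) (Real.exp (-s / 2) • y))⟫ with hPdef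
  set A : ℝ := ‖curl (V (-Real.exp (-s))) (Real.exp (-s / 2) • y)‖ with hA
  set B : ℝ := ‖curl (curl (V (-Real.exp (-s)))) (Real.exp (-s / 2) • y)‖ with hB
  have eL : ⟪lerayOrbit V s y, cross (lerayVorticity V s y) (curl (lerayVorticity V s) y)⟫ =
      Real.exp (-s) * (Real.exp (-s) * Real.exp (-s / 2)) * (Real.exp (-s / 2) * P) := by
    rw [hU, hΩ, hC, cross_smul_left, cross_smul_right, real_inner_smul_left, real_inner_smul_right,
      real_inner_smul_right]
    ring
  have eR : ‖lerayVorticity V s y‖ * ‖curl (lerayVorticity V s) y‖ =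
      Real.exp (-s) * (Real.exp (-s) * Real.exp (-s / 2)) * (A * B) := by
    rw [hΩ, hC, norm_smul, norm_smul, Real.norm_of_nonneg hk0.le,
      Real.norm_of_nonneg (mul_pos hk0 hl0).le]
    ring
  have hw : 0 ≤ Real.exp (-s) * (Real.exp (-s) * Real.exp (-s / 2)) := by positivity
  rw [eL, eR]
  exact mul_le_mul_of_nonneg_left h hw

end Scaling

/-! ### Closedness under KNSS limits -/

section Closed

/-- **The product hypothesis is closed under KNSS limits**, even with constants `θ_j → θ`: if
`v_j → W` as in `…Compactness.seqLimit` (class `C`, uniformly on the slab pieces, pointwise,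
pointwise gradients) and `√(−t)⟪v_j, ω_j × curl ω_j⟫ ≤ θ_j‖ω_j‖‖curl ω_j‖` everywhere, then
`√(−t)⟪W, ω × curl ω⟫ ≤ θ‖ω‖‖curl ω‖` everywhere (the second vorticity derivatives converge
pointwise at every `t < 0`, `…EndpointScheme.tendsto_curl_curl_of_unif`). [cite: KochNadirashviliSereginSverak2009, Prop. 4.1 (arXiv:0709.3599 p. 8)] -/
theorem lambProduct_closed_of_tendsto {v : ℕ → ℝ → EuclideanSpace ℝ (Fin 3) → EuclideanSpace ℝ (Fin 3)}
    {W : ℝ → EuclideanSpace ℝ (Fin 3) → EuclideanSpace ℝ (Fin 3)}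
    (hv : ∀ j, IsTypeIAncientMild C (v j)) (hW : IsTypeIAncientMild C W)
    (hunif : ∀ n : ℕ, TendstoUniformlyOn (fun j z => v j z.1 z.2) (fun z => W z.1 z.2) atTop
      (Icc (-((n : ℝ) + 2)) (-(1 / ((n : ℝ) + 2))) ×ˢ
        closedBall (0 : EuclideanSpace ℝ (Fin 3)) ((n : ℝ) + 2)))
    (hpt : ∀ t < 0, ∀ x, Tendsto (fun j => v j t x) atTop (𝓝 (W t x)))
    (hgr : ∀ t < 0, ∀ x, Tendsto (fun j => fderiv ℝ (v j t) x) atTop (𝓝 (fderiv ℝ (W t) x)))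
    {θ : ℕ → ℝ} {θinf : ℝ} (hθ : Tendsto θ atTop (𝓝 θinf))
    (hP : ∀ j, ∀ t < 0, ∀ x,
      Real.sqrt (-t) * ⟪v j t x, cross (curl (v j t) x) (curl (curl (v j t)) x)⟫ ≤
        θ j * (‖curl (v j t) x‖ * ‖curl (curl (v j t)) x‖)) :
    ∀ t < 0, ∀ x, Real.sqrt (-t) * ⟪W t x, cross (curl (W t) x) (curl (curl (W t)) x)⟫ ≤
      θinf * (‖curl (W t) x‖ * ‖curl (curl (W t)) x‖) := by
  intro t ht x
  -- opaque names for the three convergent sequences and their limits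
  obtain ⟨a, ha⟩ : ∃ a : ℕ → EuclideanSpace ℝ (Fin 3), ∀ j, a j = v j t x := ⟨_, fun j => rfl⟩
  obtain ⟨b, hb⟩ : ∃ b : ℕ → EuclideanSpace ℝ (Fin 3), ∀ j, b j = curl (v j t) x := ⟨_, fun j => rfl⟩
  obtain ⟨d, hd⟩ : ∃ d : ℕ → EuclideanSpace ℝ (Fin 3), ∀ j, d j = curl (curl (v j t)) x :=
    ⟨_, fun j => rfl⟩
  have hta : Tendsto a atTop (𝓝 (W t x)) := (hpt t ht x).congr fun j => (ha j).symm
  have htb : Tendsto b atTop (𝓝 (curl (W t) x)) :=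
    (tendsto_curl_of_fderiv (hgr t ht x)).congr fun j => (hb j).symm
  have htd : Tendsto d atTop (𝓝 (curl (curl (W t)) x)) :=
    (tendsto_curl_curl_of_unif hv hW hunif ht x).congr fun j => (hd j).symm
  -- the cross product and the inner product are continuous
  have hcr : Tendsto (fun j => cross (b j) (d j)) atTop (𝓝 (cross (curl (W t) x) (curl (curl (W t)) x))) := by
    have h := ((crossCLM.continuous₂).tendsto (curl (W t) x, curl (curl (W t)) x)).comp
      (htb.prodMk_nhds htd)
    refine h.congr fun j => ?_
    simp [Function.comp, crossCLM_apply]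
  have hinner : Tendsto (fun j => ⟪a j, cross (b j) (d j)⟫) atTop
      (𝓝 ⟪W t x, cross (curl (W t) x) (curl (curl (W t)) x)⟫) := hta.inner hcr
  have hL : Tendsto (fun j => Real.sqrt (-t) * ⟪a j, cross (b j) (d j)⟫) atTop
      (𝓝 (Real.sqrt (-t) * ⟪W t x, cross (curl (W t) x) (curl (curl (W t)) x)⟫)) :=
    hinner.const_mul _
  have hR : Tendsto (fun j => θ j * (‖b j‖ * ‖d j‖)) atTop
      (𝓝 (θinf * (‖curl (W t) x‖ * ‖curl (curl (W t)) x‖))) := hθ.mul (htb.norm.mul htd.norm)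
  exact le_of_tendsto_of_tendsto' hL hR fun j => by rw [ha, hb, hd]; exact hP j t ht x

/-- The product hypothesis at `θ = 1` is closed under KNSS limits. [cite: KochNadirashviliSereginSverak2009, Prop. 4.1 (arXiv:0709.3599 p. 8)] -/
theorem lambProduct_closed {v : ℕ → ℝ → EuclideanSpace ℝ (Fin 3) → EuclideanSpace ℝ (Fin 3)}
    {W : ℝ → EuclideanSpace ℝ (Fin 3) → EuclideanSpace ℝ (Fin 3)}
    (hv : ∀ j, IsTypeIAncientMild C (v j)) (hW : IsTypeIAncientMild C W)
    (hunif : ∀ n : ℕ, TendstoUniformlyOn (fun j z => v j z.1 z.2) (fun z => W z.1 z.2) atTop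
      (Icc (-((n : ℝ) + 2)) (-(1 / ((n : ℝ) + 2))) ×ˢ
        closedBall (0 : EuclideanSpace ℝ (Fin 3)) ((n : ℝ) + 2)))
    (hpt : ∀ t < 0, ∀ x, Tendsto (fun j => v j t x) atTop (𝓝 (W t x)))
    (hgr : ∀ t < 0, ∀ x, Tendsto (fun j => fderiv ℝ (v j t) x) atTop (𝓝 (fderiv ℝ (W t) x)))
    (hP : ∀ j, ∀ t < 0, ∀ x,
      Real.sqrt (-t) * ⟪v j t x, cross (curl (v j t) x) (curl (curl (v j t)) x)⟫ ≤
        ‖curl (v j t) x‖ * ‖curl (curl (v j t)) x‖) :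
    ∀ t < 0, ∀ x, Real.sqrt (-t) * ⟪W t x, cross (curl (W t) x) (curl (curl (W t)) x)⟫ ≤
      ‖curl (W t) x‖ * ‖curl (curl (W t)) x‖ := by
  have h := lambProduct_closed_of_tendsto hv hW hunif hpt hgr (θ := fun _ => 1) (θinf := 1)
    tendsto_const_nhds (fun j t ht x => by rw [one_mul]; exact hP j t ht x)
  intro t ht x
  have := h t ht x
  rwa [one_mul] at this

end Closed

/-! ### The threshold is not attained -/

section Threshold

/-- **THE PRODUCT THRESHOLD ONE IS NOT ATTAINED (law-free).** A KNSS-gauge Type-I ancient mild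
field `V` (`IsTypeIAncientMild C V`) with a Type-I envelope `HasTypeIDecay C V` such that at every
`t < 0`, `x`: `√(−t)⟪V(t,x), ω × curl ω⟫ ≤ ‖ω‖‖curl ω‖` (`ω = curl V(t)`, all evaluated at
`(t,x)`), vanishes identically on `t < 0`. Proof: the antitone-enstrophy endpoint scheme in slack
form — the hypothesis is scale invariant and KNSS-closed, the slack density of the global
similarity-enstrophy budget is `(‖curl Ω‖ − ½‖Ω‖)² + (‖Ω‖‖curl Ω‖ − ⟪U, Ω × curl Ω⟫) ≥ 0`, and its
vanishing on an enveloped slice kills that slice's vorticity by analyticity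
(`…LambProductRigidity`). The tree's row T49′ needs `θ < 1`. [folklore energy method + KNSS compactness] -/
theorem eq_zero_of_lambProduct_le_one (hV : IsTypeIAncientMild C V) (hdec : HasTypeIDecay C V)
    (hP : ∀ t < 0, ∀ x, Real.sqrt (-t) * ⟪V t x, cross (curl (V t) x) (curl (curl (V t)) x)⟫ ≤
      ‖curl (V t) x‖ * ‖curl (curl (V t)) x‖) :
    ∀ t < 0, ∀ x, V t x = 0 := by
  refine eq_zero_of_slack_scheme (C := C)
    (P := fun F => ∀ t < 0, ∀ x,
      Real.sqrt (-t) * ⟪F t x, cross (curl (F t) x) (curl (curl (F t)) x)⟫ ≤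
        ‖curl (F t) x‖ * ‖curl (curl (F t)) x‖)
    (fun F c hc hF => lambProduct_nsRescale hc hF)
    (fun u W hu _ hPu hW hunif hpt hgr => lambProduct_closed hu hW hunif hpt hgr hPu)
    (fun F hF _ hPF s y => lambProductSlack_nonneg (lambProduct_sim_of_phys hPF s y))
    (fun F hF hdF hPF s hσ => lerayVorticity_slice_eq_zero_of_lambProductSlack_eq_zero hF hdF s
      (lambProduct_sim_of_phys hPF s) hσ)
    hV hdec hP

/-- **Regularity form**: an enveloped field of the class with the product bound is NOT singular at
the apex. [folklore] -/
theorem not_singular_of_lambProduct_le_one (hV : IsTypeIAncientMild C V) (hdec : HasTypeIDecay C V)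
    (hP : ∀ t < 0, ∀ x, Real.sqrt (-t) * ⟪V t x, cross (curl (V t) x) (curl (curl (V t)) x)⟫ ≤
      ‖curl (V t) x‖ * ‖curl (curl (V t)) x‖) :
    ¬ (∀ r > 0, ∀ M : ℝ, ∃ t ∈ Set.Ioo (-(r ^ 2)) (0 : ℝ),
        ∃ x ∈ Metric.ball (0 : EuclideanSpace ℝ (Fin 3)) r, M < ‖V t x‖) := by
  intro hsing
  obtain ⟨t, ht, x, -, hM⟩ := hsing 1 one_pos 0
  rw [eq_zero_of_lambProduct_le_one hV hdec hP t ht.2 x, norm_zero] at hM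
  exact lt_irrefl _ hM

/-- **PORTRAIT: somewhere the flow along the vortex-Lamb vector strictly exceeds the self-similar
speed.** A KNSS-gauge Type-I field with a Type-I envelope (constants equalised to `A ≥ C`) which is
SINGULAR at the apex has a point `(t, x)`, `t < 0`, with
`‖curl W(t,x)‖·‖curl curl W(t,x)‖ < √(−t)⟪W(t,x), curl W(t,x) × curl curl W(t,x)⟫`.
[folklore energy method + KNSS compactness] -/
theorem lambProduct_exceeds_of_singular {A : ℝ} (hV : IsTypeIAncientMild C V) (hCA : C ≤ A)
    (hdec : HasTypeIDecay A V)
    (hsing : ∀ r > 0, ∀ M : ℝ, ∃ t ∈ Set.Ioo (-(r ^ 2)) (0 : ℝ),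
        ∃ x ∈ Metric.ball (0 : EuclideanSpace ℝ (Fin 3)) r, M < ‖V t x‖) :
    ∃ t : ℝ, t < 0 ∧ ∃ x : EuclideanSpace ℝ (Fin 3),
      ‖curl (V t) x‖ * ‖curl (curl (V t)) x‖ <
        Real.sqrt (-t) * ⟪V t x, cross (curl (V t) x) (curl (curl (V t)) x)⟫ := by
  by_contra h
  push Not at h
  exact not_singular_of_lambProduct_le_one (isTypeIAncientMild_of_le hV hCA) hdec h hsing

end Threshold

/-! ### The three sub-rows at their endpoint -/

section SubRows

/-- **The Λ-directional threshold one is not attained** (endpoint of T49): an enveloped KNSS-gauge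
Type-I field with `√(−t)⟪V, Λ⟫ ≤ ‖Λ‖`, `Λ = ω × curl ω`, everywhere — the velocity component along
the vortex-Lamb vector never exceeds the self-similar speed — vanishes identically.
[folklore energy method + KNSS compactness] -/
theorem eq_zero_of_lambDirection_le_one (hV : IsTypeIAncientMild C V) (hdec : HasTypeIDecay C V)
    (hΛ : ∀ t < 0, ∀ x, Real.sqrt (-t) * ⟪V t x, cross (curl (V t) x) (curl (curl (V t)) x)⟫ ≤
      ‖cross (curl (V t) x) (curl (curl (V t)) x)‖) :
    ∀ t < 0, ∀ x, V t x = 0 :=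
  eq_zero_of_lambProduct_le_one hV hdec fun t ht x =>
    (hΛ t ht x).trans (norm_cross_le_norm_mul_norm _ _)

/-- **The cross-flow threshold one** (lead g17's `…CrossFlow.eq_zero_of_crossFlow_le_one`) re-derived
through the product threshold: `√(−t)‖ω × V‖ ≤ ‖ω‖` gives `√(−t)⟪V, ω × C⟫ ≤ ‖ω‖‖C‖` for every
vector `C` by the scalar triple product. (An `example`: the declaration of record stays g17's.)
[folklore] -/
example (hV : IsTypeIAncientMild C V) (hdec : HasTypeIDecay C V)
    (hX : ∀ t < 0, ∀ x, Real.sqrt (-t) * ‖cross (curl (V t) x) (V t x)‖ ≤ ‖curl (V t) x‖) :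
    ∀ t < 0, ∀ x, V t x = 0 := by
  refine eq_zero_of_lambProduct_le_one hV hdec fun t ht x => ?_
  have hs : 0 ≤ Real.sqrt (-t) := Real.sqrt_nonneg _
  -- `√(−t)⟪V, ω × C⟫ = ⟪(√(−t)V), ω × C⟫` and `‖ω × (√(−t)V)‖ ≤ ‖ω‖`
  have h1 : ‖cross (curl (V t) x) (Real.sqrt (-t) • V t x)‖ ≤ ‖curl (V t) x‖ := by
    rw [cross_smul_right, norm_smul, Real.norm_of_nonneg hs]; exact hX t ht x
  have h2 := lambProduct_of_crossFlow_le h1 (curl (curl (V t)) x)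
  rwa [real_inner_smul_left] at h2

/-- **LAW-FREE THRESHOLD ONE ON THE ENVELOPED CLASS** (endpoint of the time-constant row): a
KNSS-gauge Type-I ancient mild field with Type-I constant `C ≤ 1` (`‖V(t,x)‖ ≤ C/√(−t)`) and a
Type-I envelope (any constant `A`) vanishes identically — `√(−t)‖V‖ ≤ 1` gives the product bound
(`⟪U, X⟫ ≤ ‖X‖ ≤ ‖Ω‖‖curl Ω‖`). The tree's T31⁗ (`typeI_ancient_eq_zero_of_rate_lt_one`) has
`C < 1` without envelope; lead g14's `…ThresholdOne` has `C ≤ 1` on the finite-dissipation stratum.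
[folklore energy method + KNSS compactness] -/
theorem eq_zero_of_typeI_le_one_of_hasTypeIDecay {A : ℝ} (hV : IsTypeIAncientMild C V) (hC : C ≤ 1)
    (hdec : HasTypeIDecay A V) : ∀ t < 0, ∀ x, V t x = 0 := by
  -- equalise the constants to `B = max 1 A`
  have hV' : IsTypeIAncientMild (max 1 A) V := isTypeIAncientMild_of_le hV (hC.trans (le_max_left _ _))
  have hdec' : HasTypeIDecay (max 1 A) V := hasTypeIDecay_of_le hdec (le_max_right _ _)
  refine eq_zero_of_lambProduct_le_one hV' hdec' fun t ht x => ?_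
  have hs : 0 < Real.sqrt (-t) := Real.sqrt_pos.2 (neg_pos.2 ht)
  have hU : ‖Real.sqrt (-t) • V t x‖ ≤ 1 := by
    rw [norm_smul, Real.norm_of_nonneg hs.le]
    have h := hV.norm_le ht x
    calc Real.sqrt (-t) * ‖V t x‖ ≤ Real.sqrt (-t) * (C / Real.sqrt (-t)) :=
          mul_le_mul_of_nonneg_left h hs.le
      _ = C := mul_div_cancel₀ _ hs.ne'
      _ ≤ 1 := hC
  have h2 := lambProduct_of_norm_le_one hU (curl (V t) x) (curl (curl (V t)) x)
  rwa [real_inner_smul_left] at h2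

/-- **Bradshaw–Tsai OP 5.1 holds, every factor, on the Type-I DSS fields with the product bound**:
a KNSS-gauge Type-I field with a Type-I envelope, discretely self-similar on the past with any
factor `c > 1` (a hypothesis not even used), with `√(−t)⟪V, ω × curl ω⟫ ≤ ‖ω‖‖curl ω‖` everywhere,
vanishes identically. [cite: BradshawTsai2017CPDE, §5 Open Problem 5.1] -/
theorem eq_zero_of_typeI_dss_of_lambProduct_le_one {C₀ : ℝ} (hV : IsTypeIAncientMild C V)
    (hdec : HasTypeIDecay C₀ V) {c : ℝ} (_hc : 1 < c)
    (_hdss : ∀ t : ℝ, t < 0 → ∀ x, c • V (c ^ 2 * t) (c • x) = V t x)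
    (hP : ∀ t < 0, ∀ x, Real.sqrt (-t) * ⟪V t x, cross (curl (V t) x) (curl (curl (V t)) x)⟫ ≤
      ‖curl (V t) x‖ * ‖curl (curl (V t)) x‖) :
    ∀ t < 0, ∀ x, V t x = 0 :=
  eq_zero_of_lambProduct_le_one (isTypeIAncientMild_of_le hV (le_max_left C C₀))
    (hasTypeIDecay_of_le hdec (le_max_right C C₀)) hP

/-- **On the finite-dissipation stratum with an envelope** (the critical element's situation): a
member of `𝒟_{C,K}` with a Type-I envelope (any constant) and the product bound is not singular;
constants need not be equal. [folklore] -/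
theorem not_singular_of_lambProduct_le_one' {A : ℝ} (hV : IsTypeIAncientMild C V)
    (hdec : HasTypeIDecay A V)
    (hP : ∀ t < 0, ∀ x, Real.sqrt (-t) * ⟪V t x, cross (curl (V t) x) (curl (curl (V t)) x)⟫ ≤
      ‖curl (V t) x‖ * ‖curl (curl (V t)) x‖) :
    ¬ (∀ r > 0, ∀ M : ℝ, ∃ t ∈ Set.Ioo (-(r ^ 2)) (0 : ℝ),
        ∃ x ∈ Metric.ball (0 : EuclideanSpace ℝ (Fin 3)) r, M < ‖V t x‖) :=
  not_singular_of_lambProduct_le_one (isTypeIAncientMild_of_le hV (le_max_left C A))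
    (hasTypeIDecay_of_le hdec (le_max_right C A)) hP

end SubRows

end Summit.NavierStokesRegularity.NavierStokesRegularity.Theorems.FiniteDissipationLiouville.LambProduct

end
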